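import Summits.KontsevichZagierPeriods.KontsevichZagierPeriods.Theses.HurwitzMicroSectors
import Summits.KontsevichZagierPeriods.KontsevichZagierPeriods.Theorems.HurwitzMicroSectorsNormalFormPrinciplePiBoxTransfer
import Summits.KontsevichZagierPeriods.KontsevichZagierPeriods.Theorems.HurwitzMicroSectorsNormalFormPrincipleBoxRigidityDimOne

/-! TTRL-lite variant V2337 of stmt-KontsevichZagierPeriods-3869

Variant V2337 = `stub_boxRigidity` (the leaf BoxRigidity of `NormalFormPrinciple`: two representations on
open unit boxes with integrands of KZ's rational shape and equal values are KZ-equivalent) under the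
move `fix_nat:m'=2; bound_nat:m≤2` — the right dimension FROZEN to `2` and the left dimension BOUNDED by
`2`. Verdict of the attempt seat: **open** — this file is the certificate, not a proof of the variant.

Unlike every one-sided variant of this stub (`…Variants2200/2219/2231/2241/2246/2251/2256/2261`, each
provably EQUIVALENT to the parent leaf through the `0`-dimensional slice), this bound is genuinely
TWO-sided, so the variant is a proper fragment of the leaf, and the certificate locates it exactly:

* `boxRigidityLe_iff_boxVanishingAt k` — for every `k`, BoxRigidity for all pairs of dimensions
  `m, m' ≤ k` is equivalent to BoxVanishing in the SINGLE dimension `k` (pad to the `k`-box by `pad_le`,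
  subtract on the common box by `sub_same`, soundness; conversely compare with the zero representation;
  the two directions also landed, under the same names, with the mirror variant V2204 — private here);
* hence `V2337 ⟺ BoxVanishing(2) ⟺ BoxRigidity(m, m' ≤ 2) ⟺ V2204`
  (`stub_boxRigidity_var2337_iff_boxVanishing_two`, `…_iff_le_two`, `…_iff_var2204`): the variant is
  precisely **Conjecture 1 for box-rational representations of dimension two**, the same fragment as
  its mirror `fix m := 2; m' ≤ 2`;
* `KontsevichZagierPeriods → V2337` (`stub_boxRigidity_var2337_of_statement`): a refutation of the
  variant would refute the Summit for the tree's calculus;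
* the rung below is a theorem: the same statement with `2 ↦ 1` is `boxRigidity_of_le_one` (Baker),
  `stub_boxRigidity_var2337_rung_one`;
* the rung itself is transcendence-grade: `V2337` yields Conjecture 1 on EVERY weight-two level family
  `[(0,1)², p/(1 − (x₀x₁)ⁿ)]`, `n ≥ 1`, at once and unconditionally
  (`levelFamily_of_stub_boxRigidity_var2337`), whereas the tree holds these layers only conditionally on
  independence statements that are open or of 2024 vintage (`boxRigidity_levelTwo` ⟸ `Indep_ℚ(1, π², log 2)`,
  `CatalanSectorTwoFour` ⟸ `Indep_ℚ(1, π², G)`, `SectorTwoSix` ⟸ Calegari–Dimitrov–Tang); among its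
  instances is "`G = c → [(0,1)², 1/(1 + x₀²x₁²)] ∼ [(0,1)², c]`" for every `c ∈ ℚ` (`G` = Catalan's
  constant), which no argument short of the irrationality of `G` or an explicit chain can settle.
Source: M. Kontsevich, D. Zagier, *Periods* (2001), §1.2 Conjecture 1; A. Baker, *Transcendental Number
Theory* (1975), Thm. 2.1 (the rung below). Pure proof file, no definitions. -/

-- `Summit.<Summit>.<Problem>` is the tree's mandated summit-side namespace (CONVENTIONS §2); for this
-- single-conjunct summit the two coincide, so the duplicate is deliberate.
set_option linter.dupNamespace false

noncomputable section

namespace Summit.KontsevichZagierPeriods.KontsevichZagierPeriods.Theorems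

open MeasureTheory Set
open Literature.NumberTheory.Transcendental Literature.NumberTheory.Transcendental.KZ
open Summit.KontsevichZagierPeriods.KontsevichZagierPeriods.Theses.HurwitzMicroSectors
open Summit.KontsevichZagierPeriods.HurwitzMicroSectors.NormalFormPrinciple.PiBox
open Summit.KontsevichZagierPeriods.HurwitzMicroSectors.NormalFormPrinciple.PiBox.stub_boxCombineAux
  (pad_le sub_same)

/-! ## Two-sided bounds: BoxRigidity in dimensions `≤ k` is BoxVanishing in dimension `k`

The two directions are in the tree as `boxRigidityLe_of_boxVanishingAt` / `boxVanishingAt_of_boxRigidityAt`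
(landed with the mirror variant V2204, file `…Variants2204`, minutes before this file); private copies
(`…_aux`) are kept here so that this certificate elaborates independently of that sibling, and they are
packaged as an `iff` and instantiated below. -/

/-- BoxVanishing in ONE dimension `k` gives BoxRigidity for all pairs of dimensions `m, m' ≤ k`: pad both
representations to the `k`-box by unit intervals (`pad_le`: one Newton–Leibniz move and two null faces
per step), subtract the integrands on the common box (`sub_same`, rule 1b)); the difference is
box-rational of dimension `k` and has value `0` by soundness, so it is a relation.
[cite: KontsevichZagier2001, §1.2 Conjecture 1] -/
private theorem rigidityLe_of_vanishingAt_aux (k : ℕ)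
    (hvan : ∀ (M : IntegralRep k), M.domain = {x | ∀ i, x i ∈ Set.Ioo (0:ℝ) 1} → M.IsRational →
      M.value = 0 → of M ∈ relations)
    {m m' : ℕ} (hm : m ≤ k) (hm' : m' ≤ k) (N : IntegralRep m) (N' : IntegralRep m')
    (hNd : N.domain = {x | ∀ i, x i ∈ Set.Ioo (0:ℝ) 1}) (hNr : N.IsRational)
    (hN'd : N'.domain = {x | ∀ i, x i ∈ Set.Ioo (0:ℝ) 1}) (hN'r : N'.IsRational)
    (hv : N.value = N'.value) : Equivalent N N' := by
  obtain ⟨R₁, h₁d, h₁r, h₁⟩ := pad_le hm N hNd hNr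
  obtain ⟨R₂, h₂d, h₂r, h₂⟩ := pad_le hm' N' hN'd hN'r
  obtain ⟨M, hMd, hMr, hM⟩ := sub_same R₁ R₂ h₁d h₁r h₂d h₂r
  have e1 := relations_le_ker_eval_holds h₁
  have e2 := relations_le_ker_eval_holds h₂
  have e := relations_le_ker_eval_holds hM
  rw [AddMonoidHom.mem_ker, map_sub, eval_of, eval_of, sub_eq_zero] at e1 e2
  rw [AddMonoidHom.mem_ker, map_sub, map_sub, eval_of, eval_of, eval_of, ← e1, ← e2, hv, sub_self,
    zero_sub, neg_eq_zero] at e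
  have hR : of R₁ - of R₂ ∈ relations := by
    have := relations.add_mem hM (hvan M hMd hMr e)
    rwa [sub_add_cancel] at this
  have h : of N - of N' = (of N - of R₁) + (of R₁ - of R₂) - (of N' - of R₂) := by abel
  show of N - of N' ∈ relations
  rw [h]
  exact relations.sub_mem (relations.add_mem h₁ hR) h₂

/-- BoxRigidity between representations of ONE dimension `k` gives BoxVanishing in dimension `k`
(compare a value-`0` representation with the zero representation on the `k`-box, which is box-rational
of value `0` and itself a relation). [cite: KontsevichZagier2001, §1.2 Conjecture 1] -/
private theorem vanishingAt_of_rigidityAt_aux (k : ℕ)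
    (hrig : ∀ (N N' : IntegralRep k),
      N.domain = {x | ∀ i, x i ∈ Set.Ioo (0:ℝ) 1} → N.IsRational →
      N'.domain = {x | ∀ i, x i ∈ Set.Ioo (0:ℝ) 1} → N'.IsRational →
      N.value = N'.value → Equivalent N N') :
    ∀ (M : IntegralRep k), M.domain = {x | ∀ i, x i ∈ Set.Ioo (0:ℝ) 1} → M.IsRational →
      M.value = 0 → of M ∈ relations := by
  intro M hMd hMr hv
  obtain ⟨Z, hZd, hZi⟩ := exists_zeroRep (isSemialgebraic_box k)
  have hZ : of Z ∈ relations := of_mem_relations_of_eqOn_zero Z (by simp [hZi, EqOn])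
  have hZv : Z.value = 0 := by simp [IntegralRep.value, hZi]
  have hZr : Z.IsRational := ⟨0, 1, fun x _ => by simp, fun x _ => by simp [hZi]⟩
  have h : of M - of Z ∈ relations := hrig M Z hMd hMr hZd hZr (by rw [hv, hZv])
  have := relations.add_mem h hZ
  rwa [sub_add_cancel] at this

/-- **Two-sided bounds collapse to one dimension**: BoxRigidity for all `m, m' ≤ k` ⟺ BoxVanishing in
dimension `k`. [cite: KontsevichZagier2001, §1.2 Conjecture 1] -/
theorem boxRigidityLe_iff_boxVanishingAt (k : ℕ) :
    (∀ (m m' : ℕ) (N : IntegralRep m) (N' : IntegralRep m'), m ≤ k → m' ≤ k →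
      N.domain = {x | ∀ i, x i ∈ Set.Ioo (0:ℝ) 1} → N.IsRational →
      N'.domain = {x | ∀ i, x i ∈ Set.Ioo (0:ℝ) 1} → N'.IsRational →
      N.value = N'.value → Equivalent N N') ↔
    (∀ (M : IntegralRep k), M.domain = {x | ∀ i, x i ∈ Set.Ioo (0:ℝ) 1} → M.IsRational →
      M.value = 0 → of M ∈ relations) :=
  ⟨fun h => vanishingAt_of_rigidityAt_aux k fun N N' => h k k N N' le_rfl le_rfl,
    fun h _ _ N N' hm hm' => rigidityLe_of_vanishingAt_aux k h hm hm' N N'⟩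

/-! ## The variant V2337: exactly Conjecture 1 for box-rational representations of dimension two -/

/-- **V2337 ⟺ BoxVanishing in dimension `2`**: every box-rational representation on `(0,1)²` of value
`0` is a relation. [cite: KontsevichZagier2001, §1.2 Conjecture 1] -/
theorem stub_boxRigidity_var2337_iff_boxVanishing_two :
    (∀ (m : ℕ) (N : IntegralRep m) (N' : IntegralRep 2), m ≤ 2 → N.domain = {x | ∀ i, x i ∈ Set.Ioo (0:ℝ) 1} → N.IsRational → N'.domain = {x | ∀ i, x i ∈ Set.Ioo (0:ℝ) 1} → N'.IsRational → N.value = N'.value → Equivalent N N') ↔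
    (∀ (M : IntegralRep 2), M.domain = {x | ∀ i, x i ∈ Set.Ioo (0:ℝ) 1} → M.IsRational →
      M.value = 0 → of M ∈ relations) :=
  ⟨fun h => vanishingAt_of_rigidityAt_aux 2 fun N N' => h 2 N N' le_rfl,
    fun h _ N N' hm => rigidityLe_of_vanishingAt_aux 2 h hm le_rfl N N'⟩

/-- **V2337 ⟺ BoxRigidity in dimensions `m, m' ≤ 2`** (the symmetric two-sided bound: freezing the
right dimension to `2` loses nothing against bounding it by `2`, by padding).
[cite: KontsevichZagier2001, §1.2 Conjecture 1] -/
theorem stub_boxRigidity_var2337_iff_le_two :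
    (∀ (m : ℕ) (N : IntegralRep m) (N' : IntegralRep 2), m ≤ 2 → N.domain = {x | ∀ i, x i ∈ Set.Ioo (0:ℝ) 1} → N.IsRational → N'.domain = {x | ∀ i, x i ∈ Set.Ioo (0:ℝ) 1} → N'.IsRational → N.value = N'.value → Equivalent N N') ↔
    (∀ (m m' : ℕ) (N : IntegralRep m) (N' : IntegralRep m'), m ≤ 2 → m' ≤ 2 →
      N.domain = {x | ∀ i, x i ∈ Set.Ioo (0:ℝ) 1} → N.IsRational →
      N'.domain = {x | ∀ i, x i ∈ Set.Ioo (0:ℝ) 1} → N'.IsRational →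
      N.value = N'.value → Equivalent N N') :=
  ⟨fun h _ _ N N' hm hm' =>
      rigidityLe_of_vanishingAt_aux 2 (stub_boxRigidity_var2337_iff_boxVanishing_two.1 h) hm hm' N N',
    fun h m N N' hm => h m 2 N N' hm le_rfl⟩

/-- **V2337 ⟺ V2204**: the two mirror moves (`fix m' := 2; m ≤ 2` here, `fix m := 2; m' ≤ 2` there)
produce the SAME fragment of the leaf, BoxVanishing in dimension `2`.
[cite: KontsevichZagier2001, §1.2 Conjecture 1] -/
theorem stub_boxRigidity_var2337_iff_var2204 :
    (∀ (m : ℕ) (N : IntegralRep m) (N' : IntegralRep 2), m ≤ 2 → N.domain = {x | ∀ i, x i ∈ Set.Ioo (0:ℝ) 1} → N.IsRational → N'.domain = {x | ∀ i, x i ∈ Set.Ioo (0:ℝ) 1} → N'.IsRational → N.value = N'.value → Equivalent N N') ↔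
    (∀ (m' : ℕ) (N : IntegralRep 2) (N' : IntegralRep m'), m' ≤ 2 → N.domain = {x | ∀ i, x i ∈ Set.Ioo (0:ℝ) 1} → N.IsRational → N'.domain = {x | ∀ i, x i ∈ Set.Ioo (0:ℝ) 1} → N'.IsRational → N.value = N'.value → Equivalent N N') :=
  stub_boxRigidity_var2337_iff_boxVanishing_two.trans
    ⟨fun h _ N N' hm' => rigidityLe_of_vanishingAt_aux 2 h le_rfl hm' N N',
      fun h => vanishingAt_of_rigidityAt_aux 2 fun N N' => h 2 N N' le_rfl⟩

/-- **The parent leaf `BoxRigidity` ⇒ V2337** (specialisation `m' := 2`).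
[cite: KontsevichZagier2001, §1.2 Conjecture 1] -/
theorem stub_boxRigidity_var2337_of_parent
    (h : ∀ (m m' : ℕ) (N : IntegralRep m) (N' : IntegralRep m'), N.domain = {x | ∀ i, x i ∈ Set.Ioo (0:ℝ) 1} → N.IsRational → N'.domain = {x | ∀ i, x i ∈ Set.Ioo (0:ℝ) 1} → N'.IsRational → N.value = N'.value → Equivalent N N') :
    ∀ (m : ℕ) (N : IntegralRep m) (N' : IntegralRep 2), m ≤ 2 → N.domain = {x | ∀ i, x i ∈ Set.Ioo (0:ℝ) 1} → N.IsRational → N'.domain = {x | ∀ i, x i ∈ Set.Ioo (0:ℝ) 1} → N'.IsRational → N.value = N'.value → Equivalent N N' :=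
  fun m N N' _ => h m 2 N N'

/-- **`KontsevichZagierPeriods ⇒ V2337`**: the variant is a special case of Conjecture 1 for the
tree's calculus — a refutation of the variant would refute the Summit.
[cite: KontsevichZagier2001, §1.2 Conjecture 1] -/
theorem stub_boxRigidity_var2337_of_statement (h : _root_.KontsevichZagierPeriods) :
    ∀ (m : ℕ) (N : IntegralRep m) (N' : IntegralRep 2), m ≤ 2 → N.domain = {x | ∀ i, x i ∈ Set.Ioo (0:ℝ) 1} → N.IsRational → N'.domain = {x | ∀ i, x i ∈ Set.Ioo (0:ℝ) 1} → N'.IsRational → N.value = N'.value → Equivalent N N' :=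
  stub_boxRigidity_var2337_of_parent (leaves_of_statement h).1

/-- **The rung below V2337 is a theorem**: the same statement with `2 ↦ 1` (right dimension frozen to
`1`, left dimension `≤ 1`) is the tree's `boxRigidity_of_le_one` (reduced one-variable rational
integrands, Baker's theorem on linear forms in logarithms). [cite: KontsevichZagier2001, §1.2 Conjecture 1] -/
theorem stub_boxRigidity_var2337_rung_one :
    ∀ (m : ℕ) (N : IntegralRep m) (N' : IntegralRep 1), m ≤ 1 → N.domain = {x | ∀ i, x i ∈ Set.Ioo (0:ℝ) 1} → N.IsRational → N'.domain = {x | ∀ i, x i ∈ Set.Ioo (0:ℝ) 1} → N'.IsRational → N.value = N'.value → Equivalent N N' :=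
  fun m N N' hm => Dlog.boxRigidity_of_le_one m 1 hm le_rfl N N'

/-- **BoxVanishing in dimension `1` is a theorem** (instance `k = 1` of
`boxRigidityLe_iff_boxVanishingAt` and `boxRigidity_of_le_one`); V2337 is BoxVanishing in dimension `2`.
[cite: KontsevichZagier2001, §1.2 Conjecture 1] -/
theorem boxVanishing_one :
    ∀ (M : IntegralRep 1), M.domain = {x | ∀ i, x i ∈ Set.Ioo (0:ℝ) 1} → M.IsRational →
      M.value = 0 → of M ∈ relations :=
  (boxRigidityLe_iff_boxVanishingAt 1).1 fun m m' N N' hm hm' => Dlog.boxRigidity_of_le_one m m' hm hm' N N'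

/-- The level denominators `1 − (x₀x₁)ⁿ`, `n ≥ 1`, do not vanish on the open unit box. [folklore] -/
theorem aeval_one_sub_pow_ne_zero {n : ℕ} (hn : 1 ≤ n) (x : Fin 2 → ℝ)
    (hx : x ∈ {x : Fin 2 → ℝ | ∀ i, x i ∈ Set.Ioo (0:ℝ) 1}) :
    MvPolynomial.aeval x
      (1 - (MvPolynomial.X 0 * MvPolynomial.X 1) ^ n : MvPolynomial (Fin 2) ℚ) ≠ 0 := by
  have h0 := hx 0
  have h1 := hx 1
  simp only [map_sub, map_one, map_pow, map_mul, MvPolynomial.aeval_X]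
  have hlt : (x 0 * x 1) ^ n < 1 :=
    pow_lt_one₀ (mul_nonneg h0.1.le h1.1.le) (mul_lt_one_of_nonneg_of_lt_one_left h0.1.le h0.2 h1.2.le)
      (by omega)
  exact sub_ne_zero.2 (ne_of_gt hlt)

/-- **V2337 ⇒ Conjecture 1 on EVERY weight-two level family at once, unconditionally**: for each
`n ≥ 1`, two representations on `(0,1)²` whose integrands agree on the box with `p/(1 − (x₀x₁)ⁿ)`,
`p ∈ ℚ[x₀,x₁]`, and whose values agree are KZ-equivalent. The tree holds these layers only
conditionally (`boxRigidity_levelTwo` ⟸ `Indep_ℚ(1, π², log 2)`; the level-`4` sector ⟸ `Indep_ℚ(1, π², G)`;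
the level-`6` sector ⟸ Calegari–Dimitrov–Tang 2024), which is the honest measure of the variant.
[cite: KontsevichZagier2001, §1.2 Conjecture 1] -/
theorem levelFamily_of_stub_boxRigidity_var2337
    (h : ∀ (m : ℕ) (N : IntegralRep m) (N' : IntegralRep 2), m ≤ 2 → N.domain = {x | ∀ i, x i ∈ Set.Ioo (0:ℝ) 1} → N.IsRational → N'.domain = {x | ∀ i, x i ∈ Set.Ioo (0:ℝ) 1} → N'.IsRational → N.value = N'.value → Equivalent N N')
    {n : ℕ} (hn : 1 ≤ n) (N N' : IntegralRep 2)
    (hNd : N.domain = {x | ∀ i, x i ∈ Set.Ioo (0:ℝ) 1})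
    (hN : ∃ p : MvPolynomial (Fin 2) ℚ, EqOn N.integrand
      (fun x => (MvPolynomial.aeval x p : ℝ) /
        MvPolynomial.aeval x (1 - (MvPolynomial.X 0 * MvPolynomial.X 1) ^ n : MvPolynomial (Fin 2) ℚ))
      N.domain)
    (hN'd : N'.domain = {x | ∀ i, x i ∈ Set.Ioo (0:ℝ) 1})
    (hN' : ∃ p : MvPolynomial (Fin 2) ℚ, EqOn N'.integrand
      (fun x => (MvPolynomial.aeval x p : ℝ) /
        MvPolynomial.aeval x (1 - (MvPolynomial.X 0 * MvPolynomial.X 1) ^ n : MvPolynomial (Fin 2) ℚ))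
      N'.domain)
    (hv : N.value = N'.value) : Equivalent N N' := by
  obtain ⟨p, hp⟩ := hN
  obtain ⟨p', hp'⟩ := hN'
  refine h 2 N N' le_rfl hNd ⟨p, _, fun x hx => aeval_one_sub_pow_ne_zero hn x ?_, hp⟩ hN'd
    ⟨p', _, fun x hx => aeval_one_sub_pow_ne_zero hn x ?_, hp'⟩ hv
  · rw [hNd] at hx; exact hx
  · rw [hN'd] at hx; exact hx

end Summit.KontsevichZagierPeriods.KontsevichZagierPeriods.Theorems
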